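/-
Copyright (c) 2026 the pub-hodgecm-mathlib formalisation cell (harness21).  Prover seat hodgecm-mathlib-K2E3-p26 (g4), Track B «K2-LIT» ∕ hLiu418
#184♮ = `stmt-HodgeConjecture-24832`, Road I v3, unit U5 «THE CLOSE», FACE-D₀ route (B3), pen «B3-ψ» (FACE-D₀ desk K2Liu-p02 (g10) DESK WORDS #11–#12,
2026-09-05).  THEOREMS ONLY.
-/
import Literature.NumberTheory.Automorphic.AdelicAdditiveCharacter   -- ★ Tate's `adeleAddChar`, `infiniteAdeleTrace`, `IsFiniteIntegral`, `adeleTraceMod_eq`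
import Literature.NumberTheory.Automorphic.AdeleBaseChange           -- ★ `AdeleRing.baseChange`, `infiniteCompletionOfComap`, `adicCompletionOfUnder_mem_adicCompletionIntegers`
import Literature.NumberTheory.Automorphic.GaloisActionAdeleRing     -- ★ `InfinitePlace.Completion.ext_of_coe` (the density argument at an infinite place)
import Mathlib.NumberTheory.NumberField.CMField
import HarnessLib

/-!
# Crux `HLiu418`, FACE-D₀ route (B3), brick «B3-ψ» — TATE'S CHARACTER UNDER BASE CHANGE: `ψ_E(x ⊗ 1) = ψ_F(x)^{[E:F]}` on `𝔸_F → 𝔸_E`,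
# i.e. `ψ_E ∘ (𝔸_F ⊗ 1) = ψ_F ∘ Tr_{E/F}`; CM corollary `ψ_L(x ⊗ 1) = ψ_{L⁺}(x)² = ψ_{L⁺}(x + x)`

Cell `hodgecm-mathlib`, crux item hLiu418 = `stmt-HodgeConjecture-24832`, route of record `HCCMUnconditional`; squad K2 ∕ K2Liu, socket #42F′, FACE-D₀ of ED. 2,
route (B3) «global unfolding» for the theta side's `hsign₂′`; consumer = the FACE-D₀ desk's B3-2c-idx `K2LiuKappaMultiplierIndexGram` (its by-value letter
`hψ : ∀ r, adeleAddChar L (AdeleRing.baseChange (Fp L) L r) = adeleAddChar (Fp L) r ^ 2`).  THEOREMS ONLY (no `def`, no `instance`, no notation, no named-fact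
hypothesis, no `sorry`); lane `--supports stmt-HodgeConjecture-24832 --as helper` (count-neutral).

THE MATHEMATICS [CasselsFrohlichANT1967, Ch. XV (Tate) §2.2, §4.1 Lemma 4.1.5; Ch. II (Cassels) §11].  For number fields `F ⊆ E` and the base change `𝔸_F → 𝔸_E`,
`x ↦ x ⊗ 1` (★ `AdeleRing.baseChange`), Tate's characters (★ `adeleAddChar K x = exp(−2πi · Tr_{K_∞/ℝ}(y_∞))` for `x = k + y`, `k ∈ K`, `y ∈ K_∞ × ∏ 𝒪`) satisfy
`ψ_E(x ⊗ 1) = ψ_F(x)^{[E:F]}`: choose `k ∈ F` with `x − k` finite-integral; then `(x − k) ⊗ 1 = x ⊗ 1 − k` is finite-integral in `𝔸_E` (local integers go to local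
integers), and at infinity `Tr_{E_∞/ℝ}(y ⊗ 1) = [E:F] · Tr_{F_∞/ℝ}(y)` because `Re(ι_w(y_v)) = Re(ι_v(y_v))` for `w ∣ v` (the embeddings of `w` and `v = w|_F` agree on `F`
up to complex conjugation; extend by density) and every complex embedding of `F` has exactly `[E:F]` extensions to `E` (`Σ_{w∣v} mult w = [E:F] · mult v`).
* §1 the archimedean trace: `re_extensionEmbedding_infiniteCompletionOfComap`, `card_filter_comp_algebraMap_eq`, `infiniteAdeleTrace_eq_sum_embeddings`,
  **`infiniteAdeleTrace_baseChange`** (`Tr_{E_∞/ℝ}(y ⊗ 1) = [E:F] · Tr_{F_∞/ℝ}(y)`);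
* §2 `isFiniteIntegral_baseChange`, **`adeleAddChar_baseChange`** (`ψ_E(x ⊗ 1) = ψ_F(x)^{[E:F]}`);
* §3 CM corollaries over `L⁺ = maximalRealSubfield L` (= the road's `Fp L`, reducibly): **`adeleAddChar_baseChange_cm`** (`… = ψ_{L⁺}(x)²`) and
  **`adeleAddChar_baseChange_cm_eq_add`** (`… = ψ_{L⁺}(x + x)`, the byte B3-2c-idx consumes).
HONEST LABEL.  Generic Tate-character infrastructure; count-neutral helper, closes no socket: `HC_CM` is proved only modulo the 7 printed citations (2 remaining named
inputs: hLiu418 = `stmt-HodgeConjecture-24832`, h413 = `stmt-HodgeConjecture-24833`) until rung 0 closes.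

## References
* [CasselsFrohlichANT1967] J. Tate, *Fourier analysis in number fields and Hecke's zeta-functions*, in Cassels–Fröhlich (eds.), *Algebraic Number Theory* (1967),
  Ch. XV §2.2 (`Λ_𝔭 = λ_p ∘ Tr`), §4.1 (Thm. 4.1.1, Lemma 4.1.3, Lemma 4.1.5); Ch. II (Cassels) §11 (`Σ_{w∣v} [E_w : F_v] = [E:F]`), §14 (`𝔸_E = 𝔸_F ⊗_F E`).
* [NeukirchANT1999] J. Neukirch, *Algebraic Number Theory* (1999), Ch. II (8.3)–(8.4); Ch. III §1.
-/

set_option autoImplicit false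
-- the mandated namespace repeats the single-problem summit's segment (`HodgeConjecture.HodgeConjecture`)
set_option linter.dupNamespace false

noncomputable section

open NumberField IsDedekindDomain InfinitePlace
open Literature.NumberTheory.Automorphic

namespace Summit.HodgeConjecture.HodgeConjecture.Cruxes.HLiu418.K2LiuTateCharacterBaseChange

/-! ## §1 The archimedean trace under base change: `Tr_{E_∞/ℝ}(y ⊗ 1) = [E:F] · Tr_{F_∞/ℝ}(y)` -/

section Arch

variable (F E : Type) [Field F] [Field E] [Algebra F E] [NumberField F] [NumberField E]

omit [NumberField F] [NumberField E] in
/-- **`Re ι_w(y) = Re ι_v(y)` for `w ∣ v` infinite and `y ∈ F_v ⊆ E_w`**: both sides are continuous in `y` and agree on the dense `F`, where the embedding of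
`w` restricted to `F` is the embedding of `v = w|_F` or its conjugate (Mathlib `embedding_mk_eq`). [cite: CasselsFrohlichANT1967, Ch. II §11] -/
theorem re_extensionEmbedding_infiniteCompletionOfComap (w : InfinitePlace E) (y : (w.comap (algebraMap F E)).Completion) :
    (Completion.extensionEmbedding w (infiniteCompletionOfComap F E w y)).re =
      (Completion.extensionEmbedding (w.comap (algebraMap F E)) y).re := by
  refine congrFun (Literature.NumberTheory.Automorphic.InfinitePlace.Completion.ext_of_coe (w.comap (algebraMap F E))
    (Complex.continuous_re.comp ((Completion.isometry_extensionEmbedding w).continuous.comp (continuous_infiniteCompletionOfComap F E w)))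
    (Complex.continuous_re.comp (Completion.isometry_extensionEmbedding (w.comap (algebraMap F E))).continuous) fun x => ?_) y
  simp only [Function.comp_apply]
  rw [infiniteCompletionOfComap_coe, Completion.extensionEmbedding_coe, Completion.extensionEmbedding_coe]
  change (w.embedding (algebraMap F E x)).re = ((w.comap (algebraMap F E)).embedding x).re
  have h := embedding_mk_eq (w.embedding.comp (algebraMap F E))
  rw [← comap_mk, mk_embedding] at h
  rcases h with h | h
  · rw [h]
    rfl
  · rw [h, ComplexEmbedding.conjugate_coe_eq, Complex.conj_re]
    rfl

open scoped Classical in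
/-- **Every complex embedding of `F` has exactly `[E:F]` extensions to `E`** (`ℂ` algebraically closed of characteristic `0`; Mathlib `AlgHom.card`).  Folklore,
re-proved here to keep the imports elementary (the tree's twins live in the Henniart ∕ CM-torus files). [cite: CasselsFrohlichANT1967, Ch. II §11] -/
theorem card_filter_comp_algebraMap_eq (φ : F →+* ℂ) :
    (Finset.univ.filter fun ψ : E →+* ℂ => ψ.comp (algebraMap F E) = φ).card = Module.finrank F E := by
  letI : Algebra F ℂ := φ.toAlgebra
  haveI : FiniteDimensional F E := Module.Finite.of_restrictScalars_finite ℚ F E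
  have e : {ψ : E →+* ℂ // ψ.comp (algebraMap F E) = φ} ≃ (E →ₐ[F] ℂ) :=
    { toFun := fun ψ => ⟨ψ.1, fun x => RingHom.congr_fun ψ.2 x⟩
      invFun := fun f => ⟨f.toRingHom, RingHom.ext fun x => f.commutes x⟩
      left_inv := fun _ => rfl
      right_inv := fun _ => rfl }
  rw [← Fintype.card_subtype, Fintype.card_congr e, AlgHom.card]

omit [Algebra F E] [NumberField E] in
/-- **The trace form on `F_∞` summed over embeddings**: `Tr_{F_∞/ℝ}(x) = Σ_{ψ : F → ℂ} Re ι_{[ψ]}(x_{[ψ]})` (a place of multiplicity `m` is hit by `m`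
embeddings, Mathlib `card_filter_mk_eq`). [cite: CasselsFrohlichANT1967, Ch. II §11] -/
theorem infiniteAdeleTrace_eq_sum_embeddings (x : InfiniteAdeleRing F) :
    infiniteAdeleTrace F x = ∑ ψ : F →+* ℂ, (Completion.extensionEmbedding (mk ψ) (x (mk ψ))).re := by
  classical
  rw [infiniteAdeleTrace_apply,
    ← Finset.sum_fiberwise' Finset.univ mk fun w : InfinitePlace F => (Completion.extensionEmbedding w (x w)).re]
  refine Finset.sum_congr rfl fun w _ => ?_
  rw [Finset.sum_const, card_filter_mk_eq, nsmul_eq_mul]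

/-- **`Tr_{E_∞/ℝ}(y ⊗ 1) = [E:F] · Tr_{F_∞/ℝ}(y)`** for the base change of infinite adeles `y ↦ (y_{w|_F})_w`.
[cite: CasselsFrohlichANT1967, Ch. II §11] [cite: NeukirchANT1999, Ch. II (8.4)] -/
theorem infiniteAdeleTrace_baseChange (y : InfiniteAdeleRing F) :
    infiniteAdeleTrace E (InfiniteAdeleRing.baseChange F E y) = (Module.finrank F E : ℝ) * infiniteAdeleTrace F y := by
  classical
  rw [infiniteAdeleTrace_eq_sum_embeddings, infiniteAdeleTrace_eq_sum_embeddings]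
  -- the summand at `ψ : E → ℂ` only depends on `ψ|_F` (`[ψ]|_F = [ψ ∘ ι]` is definitional)
  have h1 : ∀ ψ : E →+* ℂ, (Completion.extensionEmbedding (mk ψ) (InfiniteAdeleRing.baseChange F E y (mk ψ))).re =
      (fun φ : F →+* ℂ => (Completion.extensionEmbedding (mk φ) (y (mk φ))).re) (ψ.comp (algebraMap F E)) := fun ψ => by
    rw [InfiniteAdeleRing.baseChange_apply, re_extensionEmbedding_infiniteCompletionOfComap]
    rfl
  rw [Finset.sum_congr rfl fun ψ _ => h1 ψ,
    ← Finset.sum_fiberwise' Finset.univ (fun ψ : E →+* ℂ => ψ.comp (algebraMap F E))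
      fun φ : F →+* ℂ => (Completion.extensionEmbedding (mk φ) (y (mk φ))).re,
    Finset.mul_sum]
  refine Finset.sum_congr rfl fun φ _ => ?_
  rw [Finset.sum_const, card_filter_comp_algebraMap_eq, nsmul_eq_mul]

end Arch

/-! ## §2 Tate's character under base change -/

section Global

variable (F E : Type) [Field F] [Field E] [Algebra F E] [NumberField F] [NumberField E]

/-- Finite-integral adeles go to finite-integral adeles under base change (`𝒪_v → 𝒪_w` for `w ∣ v`, ★ `adicCompletionOfUnder_mem_adicCompletionIntegers`).
[cite: CasselsFrohlichANT1967, Ch. II §11] -/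
theorem isFiniteIntegral_baseChange {x : AdeleRing (𝓞 F) F} (hx : IsFiniteIntegral F x) : IsFiniteIntegral E (AdeleRing.baseChange F E x) := by
  intro w
  rw [AdeleRing.baseChange_snd, FiniteAdeleRing.baseChange_apply]
  exact adicCompletionOfUnder_mem_adicCompletionIntegers F E w (hx (w.under (𝓞 F)))

/-- **TATE'S CHARACTER UNDER BASE CHANGE: `ψ_E(x ⊗ 1) = ψ_F(x)^{[E:F]}`** for number fields `F ⊆ E` and every adele `x ∈ 𝔸_F` (★ `adeleAddChar`, ★
`AdeleRing.baseChange`) — i.e. `ψ_E|_{𝔸_F ⊗ 1} = ψ_F ∘ Tr_{E/F}`, Tate's `Λ_E = Λ_F ∘ Tr`.  Proof: pick `k ∈ F` with `x − k ∈ F_∞ × ∏ 𝒪_v`; then `x ⊗ 1 − k` is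
finite-integral in `𝔸_E`, so both characters are read on archimedean traces (★ `adeleTraceMod_eq`), and `Tr_{E_∞/ℝ}((x − k)_∞ ⊗ 1) = [E:F] · Tr_{F_∞/ℝ}((x − k)_∞)`
(§1). [cite: CasselsFrohlichANT1967, Ch. XV (Tate), §2.2 and §4.1 Lemma 4.1.5] [cite: CasselsFrohlichANT1967, Ch. II §11] -/
theorem adeleAddChar_baseChange (a : AdeleRing (𝓞 F) F) :
    adeleAddChar E (AdeleRing.baseChange F E a) = adeleAddChar F a ^ Module.finrank F E := by
  obtain ⟨k, hk⟩ := exists_isFiniteIntegral_sub_algebraMap F a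
  have hkE : IsFiniteIntegral E (AdeleRing.baseChange F E a - algebraMap E (AdeleRing (𝓞 E) E) (algebraMap F E k)) := by
    rw [← AdeleRing.baseChange_algebraMap, ← map_sub]
    exact isFiniteIntegral_baseChange F E hk
  rw [adeleAddChar_apply, adeleAddChar_apply, adeleTraceMod_eq E hkE, adeleTraceMod_eq F hk, ← AdeleRing.baseChange_algebraMap, ← map_sub,
    AdeleRing.baseChange_fst, infiniteAdeleTrace_baseChange, ← nsmul_eq_mul, AddCircle.coe_nsmul, ← smul_neg, AddCircle.toCircle_nsmul]

end Global

/-! ## §3 The CM corollary: `ψ_L(x ⊗ 1) = ψ_{L⁺}(x)² = ψ_{L⁺}(x + x)` -/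

section CM

variable (L : Type) [Field L] [NumberField L] [IsCMField L]

/-- **CM case**: for a CM field `L` over its maximal totally real subfield `L⁺` (`[L : L⁺] = 2`), `ψ_L(x ⊗ 1) = ψ_{L⁺}(x)²`.
[cite: CasselsFrohlichANT1967, Ch. XV (Tate), §2.2 and §4.1 Lemma 4.1.5] -/
theorem adeleAddChar_baseChange_cm (a : AdeleRing (𝓞 ↥(maximalRealSubfield L)) ↥(maximalRealSubfield L)) :
    adeleAddChar L (AdeleRing.baseChange ↥(maximalRealSubfield L) L a) = adeleAddChar ↥(maximalRealSubfield L) a ^ 2 := by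
  rw [adeleAddChar_baseChange, Algebra.IsQuadraticExtension.finrank_eq_two ↥(maximalRealSubfield L) L]

/-- **CM case, additive spelling**: `ψ_L(x ⊗ 1) = ψ_{L⁺}(x + x)` (the byte the κ-multiplier index-Gram reading consumes as `hψ`). [cite: CasselsFrohlichANT1967, Ch. XV (Tate), §4.1] -/
theorem adeleAddChar_baseChange_cm_eq_add (a : AdeleRing (𝓞 ↥(maximalRealSubfield L)) ↥(maximalRealSubfield L)) :
    adeleAddChar L (AdeleRing.baseChange ↥(maximalRealSubfield L) L a) = adeleAddChar ↥(maximalRealSubfield L) (a + a) := by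
  rw [adeleAddChar_baseChange_cm, AddChar.map_add_eq_mul, sq]

end CM

end Summit.HodgeConjecture.HodgeConjecture.Cruxes.HLiu418.K2LiuTateCharacterBaseChange

end
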